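import Summits.BirchSwinnertonDyer.BirchSwinnertonDyer.Theorems.ManinLocalTwoThreeTameCellIVstarLocalTwoTorsion
import HarnessLib

/-!
# E-imc-75 on the `IV*` cell in Tate normal form — `2`-ADIC INTEGER parameters

Summit `BirchSwinnertonDyer`, route `ManinLocalTwoThree` (cell bsd-f2-manin), crux C2 `ManinOddAtFour`
(stmt-BirchSwinnertonDyer-22967), tame cell, law E-imc-75 `TameTwoLocal.TameCellAtMostOneLocalTwoTorsionPoint`.  The sibling
file `…TameCellIVstarLocalTwoTorsion` proved the root analysis of the `IV*`-cubic for INTEGER parameters `α, α₂, α₃, α₄, α₆`;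
Tate's algorithm over `ℤ₂` (the normal-form extraction from `kodairaSymbolAt = IV*`) produces a change of variables over `ℤ₂`,
so THIS FILE (lead p1 g5) restates the analysis with parameters in `ℤ₂` (`α₃` a UNIT instead of odd; `α` a unit or not) —
`root_unique_of_IVstarCubic_padicInt` — with the same proof (norms from `‖2‖ = 1/2`, residues via `toZMod` / `toZModPow 2`).
Nothing about BSD or Manin's conjecture is proved. [cite: SilvermanATAEC1994, IV.9.4 (step 8) and Table 4.1]
-/

set_option autoImplicit false
set_option linter.dupNamespace false

noncomputable section

open scoped Classical NumberField
open WeierstrassCurve IsDedekindDomain Rat.HeightOneSpectrum Literature.NumberTheory.EllipticCurves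
open Summit.BirchSwinnertonDyer.Rank1Residual.ManinAdditive.TameTwoLocal

namespace Summit.BirchSwinnertonDyer.BirchSwinnertonDyer.Theorems.ManinLocalTwoThree

/-- **The `2`-adic root analysis of the `IV*`-cubic, `ℤ₂`-parameters.**  For `α, α₂, α₃, α₄, α₆ ∈ ℤ₂` with `α₃` a UNIT, the cubic
`x³ + (α² + 4α₂)x² + 4(2α₄ + αα₃)x + 4(α₃² + 4α₆)` has at most one root in `ℚ₂`. [folklore] -/
theorem root_unique_of_IVstarCubic_padicInt {α α₂ α₃ α₄ α₆ : ℤ_[2]} (hα₃ : IsUnit α₃) {x y : ℚ_[2]}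
    (hx : x ^ 3 + ((α ^ 2 + 4 * α₂ : ℤ_[2]) : ℚ_[2]) * x ^ 2 + ((4 * (2 * α₄ + α * α₃) : ℤ_[2]) : ℚ_[2]) * x +
      ((4 * (α₃ ^ 2 + 4 * α₆) : ℤ_[2]) : ℚ_[2]) = 0)
    (hy : y ^ 3 + ((α ^ 2 + 4 * α₂ : ℤ_[2]) : ℚ_[2]) * y ^ 2 + ((4 * (2 * α₄ + α * α₃) : ℤ_[2]) : ℚ_[2]) * y +
      ((4 * (α₃ ^ 2 + 4 * α₆) : ℤ_[2]) : ℚ_[2]) = 0) : x = y := by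
  -- local norm tools
  have h2n : ‖((2 : ℤ_[2]) : ℚ_[2])‖ = 1 / 2 := by
    have e : ((2 : ℤ_[2]) : ℚ_[2]) = 2 := by exact_mod_cast PadicInt.coe_natCast 2
    rw [e]; have := Padic.norm_p (p := 2); norm_num at this ⊢; exact_mod_cast this
  have hm1 : ∀ m : ℤ_[2], ‖(m : ℚ_[2])‖ ≤ 1 := fun m => by rw [← PadicInt.norm_def]; exact PadicInt.norm_le_one m
  have n4mul : ∀ m : ℤ_[2], ‖((4 * m : ℤ_[2]) : ℚ_[2])‖ ≤ 1 / 4 := fun m => by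
    rw [show (4 * m : ℤ_[2]) = 2 * (2 * m) by ring]; push_cast
    rw [norm_mul, norm_mul, h2n]
    nlinarith [hm1 m, norm_nonneg (m : ℚ_[2])]
  have n8mul : ∀ m : ℤ_[2], ‖((8 * m : ℤ_[2]) : ℚ_[2])‖ ≤ 1 / 8 := fun m => by
    rw [show (8 * m : ℤ_[2]) = 2 * (2 * (2 * m)) by ring]; push_cast
    rw [norm_mul, norm_mul, norm_mul, h2n]
    nlinarith [hm1 m, norm_nonneg (m : ℚ_[2])]
  have padicTwo_norm_le_half_of_lt_one : ∀ {x : ℚ_[2]}, ‖x‖ < 1 → ‖x‖ ≤ 1 / 2 := fun {x} h => by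
    have := (Padic.norm_le_pow_iff_norm_lt_pow_add_one x (-1)).mpr (by norm_num; exact h)
    norm_num at this; exact this
  -- notation and norm facts
  set B₂ : ℤ_[2] := α ^ 2 + 4 * α₂ with hB₂
  set B₄ : ℤ_[2] := 4 * (2 * α₄ + α * α₃) with hB₄
  set B₆ : ℤ_[2] := 4 * (α₃ ^ 2 + 4 * α₆) with hB₆
  have nB₂ : ‖(B₂ : ℚ_[2])‖ ≤ 1 := PadicInt.norm_le_one _
  have nB₄ : ‖(B₄ : ℚ_[2])‖ ≤ 1 / 4 := by rw [hB₄]; exact n4mul _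
  have nB₆ : ‖(B₆ : ℚ_[2])‖ ≤ 1 / 4 := by rw [hB₆]; exact n4mul _
  have nB₆' : 1 / 8 < ‖(B₆ : ℚ_[2])‖ := by
    -- `δ = α₃² + 4α₆` is a unit (≡ 1 mod 2), so `‖4δ‖ = 1/4`
    have hδu : IsUnit (α₃ ^ 2 + 4 * α₆) := by
      by_contra hnu
      have hm : α₃ ^ 2 + 4 * α₆ ∈ RingHom.ker (PadicInt.toZMod (p := 2)) := by
        rw [PadicInt.ker_toZMod]; exact (IsLocalRing.mem_maximalIdeal _).mpr hnu
      rw [RingHom.mem_ker, map_add, map_mul, map_pow, map_ofNat, toZMod_eq_one_of_isUnit hα₃] at hm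
      revert hm; generalize PadicInt.toZMod (p := 2) α₆ = z; revert z; decide
    have hδ1 : ‖((α₃ ^ 2 + 4 * α₆ : ℤ_[2]) : ℚ_[2])‖ = 1 := by
      rw [← PadicInt.norm_def]; exact PadicInt.isUnit_iff.mp hδu
    rw [hB₆, show (4 * (α₃ ^ 2 + 4 * α₆) : ℤ_[2]) = 2 * (2 * (α₃ ^ 2 + 4 * α₆)) by ring]
    push_cast [PadicInt.coe_mul] at hδ1 ⊢
    rw [norm_mul, norm_mul, h2n, hδ1]; norm_num
  -- generic facts about a root `t`
  have hroot : ∀ {t : ℚ_[2]}, t ^ 3 + (B₂ : ℚ_[2]) * t ^ 2 + (B₄ : ℚ_[2]) * t + (B₆ : ℚ_[2]) = 0 →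
      ‖t‖ ≤ 1 := fun ht => padic_norm_le_one_of_monic_cubic_root nB₂ (by linarith) (by linarith) ht
  -- (i) no root with `‖t‖ ≤ 1/4`
  have hsmall : ∀ {t : ℚ_[2]}, t ^ 3 + (B₂ : ℚ_[2]) * t ^ 2 + (B₄ : ℚ_[2]) * t + (B₆ : ℚ_[2]) = 0 →
      ¬ ‖t‖ ≤ 1 / 4 := by
    intro t ht hle
    refine padic_add_ne_zero_of_norm_lt (a := (B₆ : ℚ_[2])) (b := t ^ 3 + (B₂ : ℚ_[2]) * t ^ 2 + (B₄ : ℚ_[2]) * t)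
      (padic_norm_add3_lt ?_ ?_ ?_) (by rw [← ht]; ring)
    · rw [norm_pow]
      calc ‖t‖ ^ 3 ≤ (1 / 4) ^ 3 := by gcongr
        _ < 1 / 8 := by norm_num
        _ < _ := nB₆'
    · rw [norm_mul, norm_pow]
      calc ‖(B₂ : ℚ_[2])‖ * ‖t‖ ^ 2 ≤ 1 * (1 / 4) ^ 2 := by gcongr
        _ < 1 / 8 := by norm_num
        _ < _ := nB₆'
    · rw [norm_mul]
      calc ‖(B₄ : ℚ_[2])‖ * ‖t‖ ≤ (1 / 4) * (1 / 4) := by gcongr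
        _ < 1 / 8 := by norm_num
        _ < _ := nB₆'
  by_cases hα : ¬ IsUnit α
  · ---------------------------------------------------------------- Case `2 ∣ α`: no root at all
    exfalso
    obtain ⟨β, hβ⟩ := padicInt_two_eq_two_mul_of_not_isUnit hα
    have nB₂' : ‖(B₂ : ℚ_[2])‖ ≤ 1 / 4 := by
      rw [hB₂, hβ, show ((2 * β) ^ 2 + 4 * α₂ : ℤ_[2]) = 4 * (β ^ 2 + α₂) by ring]; exact n4mul _
    have nB₄' : ‖(B₄ : ℚ_[2])‖ ≤ 1 / 8 := by
      rw [hB₄, hβ, show (4 * (2 * α₄ + 2 * β * α₃) : ℤ_[2]) = 8 * (α₄ + β * α₃) by ring]; exact n8mul _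
    have hx1 := hroot hx
    rcases hx1.lt_or_eq with hlt | heq
    · -- `‖x‖ ≤ 1/2`: `B₆` dominates
      have hx2 := padicTwo_norm_le_half_of_lt_one hlt
      refine padic_add_ne_zero_of_norm_lt (a := (B₆ : ℚ_[2]))
        (b := x ^ 3 + (B₂ : ℚ_[2]) * x ^ 2 + (B₄ : ℚ_[2]) * x) (padic_norm_add3_lt ?_ ?_ ?_) (by rw [← hx]; ring)
      · rw [norm_pow]
        calc ‖x‖ ^ 3 ≤ (1 / 2) ^ 3 := by gcongr
          _ = 1 / 8 := by norm_num
          _ < _ := nB₆'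
      · rw [norm_mul, norm_pow]
        calc ‖(B₂ : ℚ_[2])‖ * ‖x‖ ^ 2 ≤ (1 / 4) * (1 / 2) ^ 2 := by gcongr
          _ < 1 / 8 := by norm_num
          _ < _ := nB₆'
      · rw [norm_mul]
        calc ‖(B₄ : ℚ_[2])‖ * ‖x‖ ≤ (1 / 8) * (1 / 2) := by gcongr
          _ < 1 / 8 := by norm_num
          _ < _ := nB₆'
    · -- `‖x‖ = 1`: `x³` dominates
      refine padic_add_ne_zero_of_norm_lt (a := x ^ 3)
        (b := (B₂ : ℚ_[2]) * x ^ 2 + (B₄ : ℚ_[2]) * x + (B₆ : ℚ_[2])) ?_ (by rw [← hx]; ring)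
      rw [norm_pow, heq, one_pow]
      refine padic_norm_add3_lt ?_ ?_ ?_
      · rw [norm_mul, norm_pow, heq, one_pow, mul_one]; linarith
      · rw [norm_mul, heq, mul_one]; linarith
      · linarith
  · ---------------------------------------------------------------- Case `α` a unit: roots are units, at most one
    rw [not_not] at hα
    -- (ii) no root with `‖t‖ = 1/2` (the mod-4 argument)
    have hhalf : ∀ {t : ℚ_[2]}, t ^ 3 + (B₂ : ℚ_[2]) * t ^ 2 + (B₄ : ℚ_[2]) * t + (B₆ : ℚ_[2]) = 0 →
        ‖t‖ ≠ 1 / 2 := by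
      intro t ht hn
      -- `w = t/2` is a unit of `ℤ₂`
      have h2 : ‖(2 : ℚ_[2])‖ = 1 / 2 := by
        have := Padic.norm_p (p := 2); norm_num at this ⊢; exact_mod_cast this
      have hwn : ‖t / 2‖ = 1 := by rw [norm_div, hn, h2]; norm_num
      set w : ℤ_[2] := ⟨t / 2, hwn.le⟩ with hwdef
      have hwu : IsUnit w := PadicInt.isUnit_iff.mpr (by rw [PadicInt.norm_def]; exact hwn)
      have htw : t = 2 * (w : ℚ_[2]) := by show t = 2 * (t / 2); ring
      -- the integer equation `2w³ + B₂w² + 2γw + δ = 0`, `γ = 2α₄ + αα₃`, `δ = α₃² + 4α₆`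
      set γ : ℤ_[2] := 2 * α₄ + α * α₃ with hγ
      set δ : ℤ_[2] := α₃ ^ 2 + 4 * α₆ with hδ
      set gz : ℤ_[2] := 2 * w ^ 3 + (B₂ : ℤ_[2]) * w ^ 2 + 2 * (γ : ℤ_[2]) * w + (δ : ℤ_[2]) with hgz
      have hgzQ : (gz : ℚ_[2]) = 2 * (w : ℚ_[2]) ^ 3 + (B₂ : ℚ_[2]) * (w : ℚ_[2]) ^ 2 +
          2 * (γ : ℚ_[2]) * (w : ℚ_[2]) + (δ : ℚ_[2]) := by
        have c2 : ((2 : ℤ_[2]) : ℚ_[2]) = 2 := by exact_mod_cast PadicInt.coe_natCast 2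
        have c4 : ((4 : ℤ_[2]) : ℚ_[2]) = 4 := by exact_mod_cast PadicInt.coe_natCast 4
        rw [hgz]; push_cast; simp only [c2]
      have c4 : ((4 : ℤ_[2]) : ℚ_[2]) = 4 := by exact_mod_cast PadicInt.coe_natCast 4
      have cB₄ : (B₄ : ℚ_[2]) = 4 * (γ : ℚ_[2]) := by rw [hB₄, hγ]; push_cast; simp only [c4]
      have cB₆ : (B₆ : ℚ_[2]) = 4 * (δ : ℚ_[2]) := by rw [hB₆, hδ]; push_cast; simp only [c4]
      have hg : gz = 0 := by
        have h4 : (4 : ℚ_[2]) ≠ 0 := by norm_num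
        have e : (4 : ℚ_[2]) * (gz : ℚ_[2]) = t ^ 3 + (B₂ : ℚ_[2]) * t ^ 2 + (B₄ : ℚ_[2]) * t + (B₆ : ℚ_[2]) := by
          rw [hgzQ, cB₄, cB₆, htw]; ring
        rw [ht] at e
        exact PadicInt.coe_eq_zero.mp ((mul_eq_zero.mp e).resolve_left h4)
      -- reduce mod 4
      have hmod := congrArg (PadicInt.toZModPow (p := 2) 2) hg
      rw [hgz, map_zero] at hmod
      rw [hB₂, hγ, hδ] at hmod
      simp only [map_add, map_mul, map_pow, map_ofNat] at hmod
      set F := PadicInt.toZModPow (p := 2) 2 with hF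
      have h4z : (4 : ZMod (2 ^ 2)) = 0 := by decide
      have hred : (2 * F w ^ 3 + F α ^ 2 * F w ^ 2 + 2 * (F α * F α₃) * F w + F α₃ ^ 2 : ZMod (2 ^ 2)) = 0 := by
        rw [← hmod]
        linear_combination (-(F α₂) * F w ^ 2 - F α₄ * F w - F α₆) * h4z
      obtain hw | hw := toZModPow_two_of_isUnit hwu <;>
        obtain ha | ha := toZModPow_two_of_isUnit hα <;>
          obtain ha3 | ha3 := toZModPow_two_of_isUnit hα₃ <;>
            · rw [show (F w : ZMod (2 ^ 2)) = _ from hw, show (F α : ZMod (2 ^ 2)) = _ from ha,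
                show (F α₃ : ZMod (2 ^ 2)) = _ from ha3] at hred
              revert hred; decide
    -- so every root is a UNIT
    have hunit : ∀ {t : ℚ_[2]}, t ^ 3 + (B₂ : ℚ_[2]) * t ^ 2 + (B₄ : ℚ_[2]) * t + (B₆ : ℚ_[2]) = 0 → ‖t‖ = 1 := by
      intro t ht
      rcases (hroot ht).lt_or_eq with hlt | heq
      · exfalso
        have h2 := padicTwo_norm_le_half_of_lt_one hlt
        rcases h2.lt_or_eq with hlt2 | heq2
        · exact hsmall ht (padicTwo_norm_le_quarter_of_lt_half hlt2)
        · exact hhalf ht heq2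
      · exact heq
    -- (iii) two distinct unit roots are impossible: `x² + xy + y² + B₂(x + y) + B₄` is odd
    by_contra hxy
    have hx1 := hunit hx
    have hy1 := hunit hy
    have hQ : x ^ 2 + x * y + y ^ 2 + (B₂ : ℚ_[2]) * (x + y) + (B₄ : ℚ_[2]) = 0 := by
      have hsub : (x - y) * (x ^ 2 + x * y + y ^ 2 + (B₂ : ℚ_[2]) * (x + y) + (B₄ : ℚ_[2])) = 0 := by
        linear_combination hx - hy
      rcases mul_eq_zero.mp hsub with h | h
      · exact absurd (sub_eq_zero.mp h) hxy
      · exact h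
    set xz : ℤ_[2] := ⟨x, hx1.le⟩ with hxz
    set yz : ℤ_[2] := ⟨y, hy1.le⟩ with hyz
    have hxu : IsUnit xz := PadicInt.isUnit_iff.mpr (by rw [PadicInt.norm_def]; exact hx1)
    have hyu : IsUnit yz := PadicInt.isUnit_iff.mpr (by rw [PadicInt.norm_def]; exact hy1)
    set Qz : ℤ_[2] := xz ^ 2 + xz * yz + yz ^ 2 + (B₂ : ℤ_[2]) * (xz + yz) + (B₄ : ℤ_[2]) with hQzdef
    have hQz : Qz = 0 := by
      have : (Qz : ℚ_[2]) = 0 := by rw [hQzdef]; push_cast; exact hQ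
      exact PadicInt.coe_eq_zero.mp this
    have hmod := congrArg (PadicInt.toZMod (p := 2)) hQz
    rw [hQzdef, map_zero] at hmod
    rw [hB₄] at hmod
    simp only [map_add, map_mul, map_pow, map_ofNat] at hmod
    have h4z : (4 : ZMod 2) = 0 := by decide
    rw [toZMod_eq_one_of_isUnit hxu, toZMod_eq_one_of_isUnit hyu, h4z] at hmod
    revert hmod
    generalize PadicInt.toZMod (p := 2) B₂ = b
    generalize PadicInt.toZMod (p := 2) α₄ = c
    generalize PadicInt.toZMod (p := 2) α = d
    generalize PadicInt.toZMod (p := 2) α₃ = e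
    revert b c d e; decide


/-- A `u = 1` change of variables over `ℚ₂` shifts the roots of the 2-division polynomial by `r`. [folklore] -/
theorem twoDivision_root_smul_sub_of_u_eq_one (W₂ : WeierstrassCurve ℚ_[2]) (C : VariableChange ℚ_[2]) (hu : C.u = 1)
    {x : ℚ_[2]} (hx : 4 * x ^ 3 + W₂.b₂ * x ^ 2 + 2 * W₂.b₄ * x + W₂.b₆ = 0) :
    4 * (x - C.r) ^ 3 + (C • W₂).b₂ * (x - C.r) ^ 2 + 2 * (C • W₂).b₄ * (x - C.r) + (C • W₂).b₆ = 0 := by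
  rw [variableChange_b₂, variableChange_b₄, variableChange_b₆, hu]
  simp only [inv_one, Units.val_one, one_pow, one_mul]
  linear_combination hx

/-- On a `ℤ₂`-model in `IV*`-normal form `[2α, 4α₂, 4α₃, 8α₄, 16α₆]` the roots of the 2-division polynomial are the roots of
the `IV*`-cubic. [folklore] -/
theorem IVstarCubic_eq_zero_of_twoDivision_root (M : WeierstrassCurve ℤ_[2]) {α α₂ α₃ α₄ α₆ : ℤ_[2]}
    (h₁ : M.a₁ = 2 * α) (h₂ : M.a₂ = 4 * α₂) (h₃ : M.a₃ = 4 * α₃) (h₄ : M.a₄ = 8 * α₄) (h₆ : M.a₆ = 16 * α₆)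
    {x : ℚ_[2]} (hx : 4 * x ^ 3 + (M.map PadicInt.Coe.ringHom).b₂ * x ^ 2 + 2 * (M.map PadicInt.Coe.ringHom).b₄ * x +
      (M.map PadicInt.Coe.ringHom).b₆ = 0) :
    x ^ 3 + ((α ^ 2 + 4 * α₂ : ℤ_[2]) : ℚ_[2]) * x ^ 2 + ((4 * (2 * α₄ + α * α₃) : ℤ_[2]) : ℚ_[2]) * x +
      ((4 * (α₃ ^ 2 + 4 * α₆) : ℤ_[2]) : ℚ_[2]) = 0 := by
  simp only [WeierstrassCurve.b₂, WeierstrassCurve.b₄, WeierstrassCurve.b₆, map_a₁, map_a₂, map_a₃, map_a₄, map_a₆,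
    h₁, h₂, h₃, h₄, h₆] at hx
  have c2 : ((2 : ℤ_[2]) : ℚ_[2]) = 2 := by exact_mod_cast PadicInt.coe_natCast 2
  have c4 : ((4 : ℤ_[2]) : ℚ_[2]) = 4 := by exact_mod_cast PadicInt.coe_natCast 4
  have c8 : ((8 : ℤ_[2]) : ℚ_[2]) = 8 := by exact_mod_cast PadicInt.coe_natCast 8
  have c16 : ((16 : ℤ_[2]) : ℚ_[2]) = 16 := by exact_mod_cast PadicInt.coe_natCast 16
  have e : ∀ z : ℤ_[2], (PadicInt.Coe.ringHom (p := 2)) z = (z : ℚ_[2]) := fun z => rfl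
  simp only [e] at hx
  push_cast at hx ⊢
  simp only [c2, c4, c8, c16] at hx ⊢
  linear_combination hx / 4

/-- **E-imc-75 for a curve with a `IV*`-normal form over `ℤ₂` (PROVED).**  If `W ⊗ ℚ₂` admits a `u = 1` change of variables over
`ℚ₂` to a `ℤ₂`-model `[2α, 4α₂, 4α₃, 8α₄, 16α₆]` with `α₃ ∈ ℤ₂ˣ` (the output of Tate's algorithm at type `IV*`, `p = 2`), then
the 2-division polynomial of `W` has at most one root in `ℚ₂`. [cite: SilvermanATAEC1994, IV.9.4 (step 8)] -/
theorem isLocalTwoTorsionX_unique_of_IVstarNormalForm_padic (W : WeierstrassCurve ℚ) (C : VariableChange ℚ_[2])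
    (M : WeierstrassCurve ℤ_[2]) (hu : C.u = 1)
    (hCW : C • (W.map (algebraMap ℚ ℚ_[2])) = M.map PadicInt.Coe.ringHom) {α α₂ α₃ α₄ α₆ : ℤ_[2]}
    (h₁ : M.a₁ = 2 * α) (h₂ : M.a₂ = 4 * α₂) (h₃ : M.a₃ = 4 * α₃) (hα₃ : IsUnit α₃) (h₄ : M.a₄ = 8 * α₄)
    (h₆ : M.a₆ = 16 * α₆) :
    ∀ x y : ℚ_[2], IsLocalTwoTorsionX W x → IsLocalTwoTorsionX W y → x = y := by
  have hrat : ∀ q : ℚ, algebraMap ℚ ℚ_[2] q = (q : ℚ_[2]) := fun q => by rw [eq_ratCast]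
  have hW : ∀ {x : ℚ_[2]}, IsLocalTwoTorsionX W x →
      4 * x ^ 3 + (W.map (algebraMap ℚ ℚ_[2])).b₂ * x ^ 2 + 2 * (W.map (algebraMap ℚ ℚ_[2])).b₄ * x +
        (W.map (algebraMap ℚ ℚ_[2])).b₆ = 0 := by
    intro x hx
    unfold IsLocalTwoTorsionX at hx
    rw [map_b₂, map_b₄, map_b₆, hrat, hrat, hrat]; exact hx
  intro x y hx hy
  have hx' := IVstarCubic_eq_zero_of_twoDivision_root M h₁ h₂ h₃ h₄ h₆
    (hCW ▸ twoDivision_root_smul_sub_of_u_eq_one _ C hu (hW hx))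
  have hy' := IVstarCubic_eq_zero_of_twoDivision_root M h₁ h₂ h₃ h₄ h₆
    (hCW ▸ twoDivision_root_smul_sub_of_u_eq_one _ C hu (hW hy))
  have hxy : x - C.r = y - C.r := root_unique_of_IVstarCubic_padicInt hα₃ hx' hy'
  simpa using hxy

/-- **E-imc-75 ⟸ the `IV*`-normal form over `ℤ₂`** (hypothesis stated inline: every globally minimal `W` with `4 ∥ N_W` and
`ord₂(Δ_min) = 8` has, over `ℚ₂`, a `u = 1` change to a `ℤ₂`-model in `IV*`-normal form — Tate's algorithm, steps 2/6/8, for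
`kodairaSymbolAt = IV*` read through `kodairaSymbolAt_eq_padic`).  CONDITIONAL edge. [cite: SilvermanATAEC1994, IV.9.4 and Table 4.1] -/
theorem tameCellAtMostOneLocalTwoTorsionPoint_of_IVstarNormalForm_padic
    (hNF : ∀ (W : WeierstrassCurve ℚ) [W.IsElliptic] [W.IsGloballyMinimal],
      2 ^ 2 ∣ W.conductorNorm ℤ → ¬ 2 ^ 3 ∣ W.conductorNorm ℤ → padicValInt 2 W.minimalDiscriminantInt = 8 →
      ∃ (C : VariableChange ℚ_[2]) (M : WeierstrassCurve ℤ_[2]) (α α₂ α₃ α₄ α₆ : ℤ_[2]),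
        C.u = 1 ∧ C • (W.map (algebraMap ℚ ℚ_[2])) = M.map PadicInt.Coe.ringHom ∧ M.a₁ = 2 * α ∧ M.a₂ = 4 * α₂ ∧
        M.a₃ = 4 * α₃ ∧ IsUnit α₃ ∧ M.a₄ = 8 * α₄ ∧ M.a₆ = 16 * α₆) :
    TameCellAtMostOneLocalTwoTorsionPoint := by
  refine tameCellAtMostOneLocalTwoTorsionPoint_of_IVstar ?_
  intro W _ _ h4 h8 hΔ8 x y hx hy
  obtain ⟨C, M, α, α₂, α₃, α₄, α₆, hu, hCW, h₁, h₂, h₃, hα₃, h₄, h₆⟩ := hNF W h4 h8 hΔ8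
  exact isLocalTwoTorsionX_unique_of_IVstarNormalForm_padic W C M hu hCW h₁ h₂ h₃ hα₃ h₄ h₆ x y hx hy

end Summit.BirchSwinnertonDyer.BirchSwinnertonDyer.Theorems.ManinLocalTwoThree

end
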